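import Literature.Computability.AlgebraicComplexity.MS21ANFHasseBlockLemmas
import Literature.Computability.AlgebraicComplexity.MS21ANFBlockSupport
import Literature.Computability.AlgebraicComplexity.MS21ANFSecondDerivativeHitting
import HarnessLib

/-!
# Medini–Shpilka 2021, Lemma 5.13 in every characteristic: quarter structure of a bad change of
# basis (B36 structure lemma, downstream half = stage S4; cell `val-lit`, seat t17 g5)

Theorem-only file (no definitions, no named facts, D-0026), written to the writer map of record
(lead-np RULING (74), 2026-08-27): S4 of the characteristic-free repair of
[MediniShpilka2021, Lemma 5.13 (arXiv:2102.05632 p0029:L3–L26)] whose printed bullet "`x^e` not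
multilinear, `x_i² | x^e` … clearly `∂²g/∂u∂v ≠ 0`" divides by `e_i (e_i − 1)` and fails in small
characteristic (registry item B36; blueprint `HOME/np/t18g5-MS21-thm35-B36-hasse-blueprint.md`, v2).
The repaired statement is the STRUCTURE LEMMA: for `N ∈ GL_{4^Δ}(K)`, if `Δ²_c ANF_Δ = 0` along every
column `c` of `N` and `∂_c ∂_{c'} ANF_Δ = 0` along the columns of every `+`-pair, then
`mon(ANF_Δ(Ny)) ⊆ mon(ANF_Δ)` (binder `hstruct` of `MS2021_thm_35_of_h512_hstruct`, file
`MS21ANFThm35OfStructureLemma.lean`). Its induction step `Δ → Δ + 1` splits into an UPSTREAM half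
(seat t18, file `MS21ANFHasseBlockExtraction.lean`: the block expansion of `Δ²_c (A₀A₁ + A₂A₃)`
separated by block degrees yields three blockwise consequences (AB), (H), (P) below) and the
DOWNSTREAM half proved here:

* `MS2021.card_le_card_of_rows_supportedOn` — rank count: rows `i ∈ R` of an invertible matrix
  vanishing outside a column set `U` force `|R| ≤ |U|`;
* `MS2021.exists_pderiv_pderiv_anf_eq_zero_of_union_eq_univ` — two non-empty variable sets covering
  `var(ANF_Δ)` contain a pair with vanishing mixed derivative (every `Δ`, including `Δ = 0`);
* `MS2021.exists_perm_eq_image_anfBlock` — QUARTER COMBINATORICS: four column sets `U_b` with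
  `|U_b| ≥ 4^Δ`, jointly `≥ 4^{Δ+1}`, and no pair `k ∈ U_b`, `l ∈ U_{sib b}` with
  `∂_k∂_l ANF_{Δ+1} = 0`, are whole quarters `x^{(π b)}` for a block permutation `π` with
  `π (sib b) = sib (π b)` (halves via the top addition gate, then quarters via the cover lemma);
* `MS2021.isUnit_det_blockOf_anfBlock`, `MS2021.affSubst_rename_anfBlock` — the diagonal blocks
  `M_b` of a quarter-block-monomial `M` are invertible and `A^{(b)}(My) = (ANF_Δ ∘ M_b)(x^{(π b)})`;
* `MS2021.support_affSubst_anf_succ_subset_of_blocks` — support conclusion through seat t24's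
  `support_anf_succ` / `mem_support_rename_anfBlock_mul_iff`;
* `MS2021.support_affSubst_anf_succ_subset` — THE INDUCTION STEP: (AB) + (H) + (P) + the structure
  lemma at level `Δ` give `mon(ANF_{Δ+1}(My)) ⊆ mon(ANF_{Δ+1})`;
* `MS2021.support_affSubst_anf_zero_subset` (base `Δ = 0`) and
  `MS2021.support_affSubst_anf_subset_of_extraction` — packaging by induction on `Δ`: the extraction
  layer (as a hypothesis `hS3`, seat t18's theorem) implies `hstruct` verbatim.

Coordinates are the tree's `anfBlock Δ b j` throughout (the coordinates of the consumer
`affSubst le_rfl M 0 (anf K Δ)`), which is why the block-invertibility and factorisation lemmas are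
proved here directly (≈ 60 lines) rather than transported from seat p1's product-index versions
`MS2021.isUnit_det_block` / `aeval_linSubst_rename_eq_rename_block` (`MS21ANFMonomialInclusionStep.lean`,
index `Fin 4 × Fin (4^Δ)`); `disjoint_image_anfBlock`, `sum_eq_sum_anfBlock` (t24),
`exists_pderiv_pderiv_anf_succ_eq_zero_of_union_eq_univ`, `pderiv_pderiv_anf_succ_cross` (t18),
`pderiv_pderiv_anf_succ_same`, `pderiv_pderiv_self_eq_zero_of_degreeOf_le_one` (p1/x5) are imported.

HONEST FRAMING: a step of a characteristic-free proof of a 2021 published lemma (the printed proof is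
characteristic-dependent; the route — second-order Hasse derivatives and this structure lemma — is
the cell's, disclosed as such); `MS2021_thm_35` is NOT discharged here; `VP ≠ VNP` is NOT proved and
nothing here bears on it.

## References

* [MediniShpilka2021] D. Medini, A. Shpilka, *Hitting sets and reconstruction for dense orbits in
  VP_e and ΣΠΣ circuits*, CCC 2021 (LIPIcs 200:19) = arXiv:2102.05632: Def 8 (ANF, blocks
  `x^{(b)}`, p0025:L31), Obs 5.8 (p0025:L57–L60), Lemma 5.12 and its proof (p0027:L40–p0028:L40),
  Lemma 5.13 and its proof (p0029:L3–L26), Thm 35 (p0008:L29–30).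
-/

noncomputable section

open MvPolynomial

namespace Literature.Computability.AlgebraicComplexity

namespace MS2021

section Rank

variable {K : Type*} [Field K] {ι : Type*} [Fintype ι] [DecidableEq ι]

/-- **Rank count.** If the rows `i ∈ R` of an invertible matrix vanish outside the column set `U`,
then `|R| ≤ |U|` (the rows are independent vectors of `K^U`) — the rank count behind "the `4^Δ` rows
of a block of `M ∈ GL` occupy at least `4^Δ` columns".
[cite: MediniShpilka2021, proof of Lemma 5.13 (arXiv p0029:L3-L26); folklore linear algebra] -/
theorem card_le_card_of_rows_supportedOn (M : Matrix ι ι K) (hM : IsUnit M.det)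
    (R U : Finset ι) (h : ∀ i ∈ R, ∀ k, k ∉ U → M i k = 0) : R.card ≤ U.card := by
  classical
  have hrows : LinearIndependent K (fun i => M i) :=
    Matrix.linearIndependent_rows_iff_isUnit.mpr ((Matrix.isUnit_iff_isUnit_det M).mpr hM)
  -- restrict the rows in `R` to the columns in `U`
  let v : R → (U → K) := fun i k => M i k
  have hv : LinearIndependent K v := by
    rw [Fintype.linearIndependent_iff]
    intro g hg i
    -- extend `g` by zero to all rows
    have hfull : ∑ i : R, g i • M i = 0 := by
      funext k
      rw [Finset.sum_apply, Pi.zero_apply]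
      by_cases hk : k ∈ U
      · have := congr_fun hg ⟨k, hk⟩
        simpa [v, Finset.sum_apply, Pi.smul_apply] using this
      · exact Finset.sum_eq_zero fun j _ => by
          rw [Pi.smul_apply, h j j.2 k hk, smul_zero]
    have hR : LinearIndependent K (fun i : R => M i) :=
      hrows.comp (fun i : R => (i : ι)) Subtype.val_injective
    exact (Fintype.linearIndependent_iff.mp hR g hfull) i
  have := hv.fintype_card_le_finrank
  simpa [Module.finrank_fintype_fun_eq_card] using this

end Rank


section Quarters

variable {K : Type*} [Field K]

/-- A block `x^{(c)}` of `ANF_{Δ+1}` has `4^Δ` variables. [cite: MediniShpilka2021, Def 8 (arXiv p0025:L31)] -/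
theorem card_image_anfBlock (Δ : ℕ) (c : Fin 4) :
    (Finset.univ.image (anfBlock Δ c)).card = 4 ^ Δ := by
  rw [Finset.card_image_of_injective _ (anfBlock_injective Δ c), Finset.card_univ, Fintype.card_fin]

/-- The sibling `1 - b` of a block is another block. [folklore] -/
private theorem one_sub_ne (b : Fin 4) : (1 - b : Fin 4) ≠ b := by revert b; decide

/-- `sib (sib b) = b`. [folklore] -/
private theorem one_sub_one_sub (b : Fin 4) : (1 - (1 - b) : Fin 4) = b := by revert b; decide

/-- Blocks `0, 1` hang under the left product gate, blocks `2, 3` under the right one. [folklore] -/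
private theorem low_or_high (c : Fin 4) : (c = 0 ∨ c = 1) ∨ (c = 2 ∨ c = 3) := by
  revert c; decide

variable (K) in
/-- **Two non-empty variable sets covering `var(ANF_Δ)` contain a pair with vanishing mixed
derivative**, at every level: `Δ = 0` — take `k = l` (`ANF_0 = x` is multilinear); `Δ + 1` — the
top gate is an addition gate (`exists_pderiv_pderiv_anf_succ_eq_zero_of_union_eq_univ`).
[cite: MediniShpilka2021, Def 8 and Obs 5.8 (arXiv p0025:L31, L57-L60)] -/
theorem exists_pderiv_pderiv_anf_eq_zero_of_union_eq_univ (Δ : ℕ) {S S' : Finset (Fin (4 ^ Δ))}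
    (hS : S.Nonempty) (hS' : S'.Nonempty) (hcov : S ∪ S' = Finset.univ) :
    ∃ k ∈ S, ∃ l ∈ S', pderiv k (pderiv l (anf K Δ)) = 0 := by
  cases Δ with
  | zero =>
    obtain ⟨k, hk⟩ := hS
    obtain ⟨l, hl⟩ := hS'
    have hkl : l = k := by
      have h1 := k.isLt
      have h2 := l.isLt
      simp only [pow_zero] at h1 h2
      exact Fin.ext (by omega)
    refine ⟨k, hk, l, hl, ?_⟩
    rw [hkl]
    exact pderiv_pderiv_self_eq_zero_of_degreeOf_le_one k (degreeOf_anf_le_one K 0 k)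
  | succ Δ => exact exists_pderiv_pderiv_anf_succ_eq_zero_of_union_eq_univ (K := K) Δ hS hS' hcov

/-- **Quarter combinatorics** (the counting heart of the structure lemma). Four column sets
`U_b ⊆ var(ANF_{Δ+1})` (the column supports of the row blocks of a change of basis) with
`|U_b| ≥ 4^Δ`, jointly of size `≥ 4^{Δ+1}`, and such that NO pair `k ∈ U_b`, `l ∈ U_{sib b}` has a
vanishing mixed derivative `∂_k∂_l ANF_{Δ+1} = 0` (in particular `U_b ∩ U_{sib b} = ∅` and no pair
across the top addition gate), are whole QUARTERS: `U_b = x^{(π b)}` for a permutation `π` of the four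
blocks compatible with the pairing `b ↔ 1 - b`. (Replaces the characteristic-dependent bullet of the
printed proof of Lemma 5.13.) [cite: MediniShpilka2021, Lemma 5.13 and its proof (arXiv p0029:L3-L26); Def 8] -/
theorem exists_perm_eq_image_anfBlock (Δ : ℕ) (U : Fin 4 → Finset (Fin (4 ^ (Δ + 1))))
    (hcard : ∀ b, 4 ^ Δ ≤ (U b).card)
    (hall : 4 ^ (Δ + 1) ≤ (Finset.univ.filter fun k => ∃ b, k ∈ U b).card)
    (hpair : ∀ b, ∀ k ∈ U b, ∀ l ∈ U (1 - b), pderiv k (pderiv l (anf K (Δ + 1))) ≠ 0) :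
    ∃ π : Equiv.Perm (Fin 4), (∀ b, π (1 - b) = 1 - π b) ∧
      ∀ b, U b = Finset.univ.image (anfBlock Δ (π b)) := by
  classical
  -- quarters and halves
  set C : Fin 4 → Finset (Fin (4 ^ (Δ + 1))) := fun c => Finset.univ.image (anfBlock Δ c) with hC
  have hCcard : ∀ c, (C c).card = 4 ^ Δ := fun c => card_image_anfBlock Δ c
  have hpos : 0 < 4 ^ Δ := pow_pos (by norm_num) Δ
  have hmemC : ∀ c j, anfBlock Δ c j ∈ C c := fun c j => Finset.mem_image_of_mem _ (Finset.mem_univ j)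
  set lo : Finset (Fin (4 ^ (Δ + 1))) := C 0 ∪ C 1 with hlo
  set hi : Finset (Fin (4 ^ (Δ + 1))) := C 2 ∪ C 3 with hhi
  have hlocard : lo.card = 2 * 4 ^ Δ := by
    rw [hlo, Finset.card_union_of_disjoint (disjoint_image_anfBlock Δ (by decide) _ _), hCcard, hCcard]
    ring
  have hhicard : hi.card = 2 * 4 ^ Δ := by
    rw [hhi, Finset.card_union_of_disjoint (disjoint_image_anfBlock Δ (by decide) _ _), hCcard, hCcard]
    ring
  have hlohi : Disjoint lo hi := by
    rw [hlo, hhi, Finset.disjoint_union_left, Finset.disjoint_union_right, Finset.disjoint_union_right]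
    exact ⟨⟨disjoint_image_anfBlock Δ (by decide) _ _, disjoint_image_anfBlock Δ (by decide) _ _⟩,
      disjoint_image_anfBlock Δ (by decide) _ _, disjoint_image_anfBlock Δ (by decide) _ _⟩
  have hmem_lo_or_hi : ∀ k, k ∈ lo ∨ k ∈ hi := by
    intro k
    obtain ⟨c, j, rfl⟩ := exists_eq_anfBlock Δ k
    rcases low_or_high c with (rfl | rfl) | (rfl | rfl)
    · exact Or.inl (Finset.mem_union_left _ (hmemC 0 j))
    · exact Or.inl (Finset.mem_union_right _ (hmemC 1 j))
    · exact Or.inr (Finset.mem_union_left _ (hmemC 2 j))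
    · exact Or.inr (Finset.mem_union_right _ (hmemC 3 j))
  -- across the top addition gate the mixed derivative vanishes
  have hcross : ∀ k ∈ lo, ∀ l ∈ hi, pderiv k (pderiv l (anf K (Δ + 1))) = 0 ∧
      pderiv l (pderiv k (anf K (Δ + 1))) = 0 := by
    intro k hk l hl
    rw [hlo, Finset.mem_union] at hk
    rw [hhi, Finset.mem_union] at hl
    have hk' : ∃ b j, (b = (0 : Fin 4) ∨ b = 1) ∧ k = anfBlock Δ b j := by
      rcases hk with h | h
      · obtain ⟨j, -, rfl⟩ := Finset.mem_image.mp h; exact ⟨0, j, Or.inl rfl, rfl⟩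
      · obtain ⟨j, -, rfl⟩ := Finset.mem_image.mp h; exact ⟨1, j, Or.inr rfl, rfl⟩
    have hl' : ∃ b' j', (b' = (2 : Fin 4) ∨ b' = 3) ∧ l = anfBlock Δ b' j' := by
      rcases hl with h | h
      · obtain ⟨j, -, rfl⟩ := Finset.mem_image.mp h; exact ⟨2, j, Or.inl rfl, rfl⟩
      · obtain ⟨j, -, rfl⟩ := Finset.mem_image.mp h; exact ⟨3, j, Or.inr rfl, rfl⟩
    obtain ⟨b, j, hb, rfl⟩ := hk'
    obtain ⟨b', j', hb', rfl⟩ := hl'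
    exact ⟨(pderiv_pderiv_anf_succ_cross (K := K) Δ hb hb' j j').2,
      (pderiv_pderiv_anf_succ_cross (K := K) Δ hb hb' j j').1⟩
  -- non-emptiness and disjointness of the `U b`
  have hne : ∀ b, (U b).Nonempty := fun b => Finset.card_pos.mp (lt_of_lt_of_le hpos (hcard b))
  have hdisj : ∀ b, Disjoint (U b) (U (1 - b)) := by
    intro b
    rw [Finset.disjoint_left]
    intro k hk hk'
    exact hpair b k hk k hk'
      (pderiv_pderiv_self_eq_zero_of_degreeOf_le_one k (degreeOf_anf_le_one K (Δ + 1) k))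
  -- (F4) one element of `U b` in a half forces `U (1-b)` into the same half
  have hF4lo : ∀ b, (∃ k ∈ U b, k ∈ lo) → U (1 - b) ⊆ lo := by
    rintro b ⟨k, hk, hklo⟩ l hl
    rcases hmem_lo_or_hi l with h | h
    · exact h
    · exact absurd (hcross k hklo l h).1 (hpair b k hk l hl)
  have hF4hi : ∀ b, (∃ k ∈ U b, k ∈ hi) → U (1 - b) ⊆ hi := by
    rintro b ⟨k, hk, hkhi⟩ l hl
    rcases hmem_lo_or_hi l with h | h
    · exact absurd (hcross l h k hkhi).2 (hpair b k hk l hl)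
    · exact h
  -- (F5/F6) each `U b` lies in one half, the same half as `U (1-b)`
  have hhalf : ∀ b, (U b ⊆ lo ∧ U (1 - b) ⊆ lo) ∨ (U b ⊆ hi ∧ U (1 - b) ⊆ hi) := by
    intro b
    have key : ∀ b, U b ⊆ lo ∨ U b ⊆ hi := by
      intro b
      by_contra hno
      push Not at hno
      obtain ⟨hnlo, hnhi⟩ := hno
      obtain ⟨k, hk, hklo⟩ := Finset.not_subset.mp hnlo
      obtain ⟨k', hk', hk'hi⟩ := Finset.not_subset.mp hnhi
      -- `k ∉ lo` so `k ∈ hi`; `k' ∉ hi` so `k' ∈ lo`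
      have h1 : U (1 - b) ⊆ hi := hF4hi b ⟨k, hk, (hmem_lo_or_hi k).resolve_left hklo⟩
      have h2 : U (1 - b) ⊆ lo := hF4lo b ⟨k', hk', (hmem_lo_or_hi k').resolve_right hk'hi⟩
      obtain ⟨l, hl⟩ := hne (1 - b)
      exact Finset.disjoint_left.mp hlohi (h2 hl) (h1 hl)
    obtain ⟨k, hk⟩ := hne b
    rcases key b with h | h
    · exact Or.inl ⟨h, hF4lo b ⟨k, hk, h hk⟩⟩
    · exact Or.inr ⟨h, hF4hi b ⟨k, hk, h hk⟩⟩
  -- (F7) the pair fills its half exactly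
  have hfill : ∀ b (H : Finset (Fin (4 ^ (Δ + 1)))), H.card = 2 * 4 ^ Δ → U b ⊆ H → U (1 - b) ⊆ H →
      (U b).card = 4 ^ Δ ∧ U b ∪ U (1 - b) = H := by
    intro b H hH hb hb'
    have hsub : U b ∪ U (1 - b) ⊆ H := Finset.union_subset hb hb'
    have hcu : (U b ∪ U (1 - b)).card = (U b).card + (U (1 - b)).card :=
      Finset.card_union_of_disjoint (hdisj b)
    have hle := Finset.card_le_card hsub
    have h1 := hcard b
    have h2 := hcard (1 - b)
    refine ⟨by omega, Finset.eq_of_subset_of_card_le hsub (by omega)⟩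
  -- (F8) not all four in one half
  have hnotall : ∀ H : Finset (Fin (4 ^ (Δ + 1))), H.card = 2 * 4 ^ Δ → ¬ ∀ b, U b ⊆ H := by
    intro H hH hallH
    have hsub : (Finset.univ.filter fun k => ∃ b, k ∈ U b) ⊆ H := by
      intro k hk
      obtain ⟨b, hb⟩ := (Finset.mem_filter.mp hk).2
      exact hallH b hb
    have := Finset.card_le_card hsub
    have h4 : 4 ^ (Δ + 1) = 4 ^ Δ * 4 := pow_succ 4 Δ
    omega
  -- (F9) a quarter inside the pair's half lies entirely in one of the two sets
  have hquarter : ∀ b c, C c ⊆ U b ∪ U (1 - b) → C c ⊆ U b ∨ C c ⊆ U (1 - b) := by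
    intro b c hc
    set S : Finset (Fin (4 ^ Δ)) := Finset.univ.filter fun j => anfBlock Δ c j ∈ U b with hS
    set S' : Finset (Fin (4 ^ Δ)) := Finset.univ.filter fun j => anfBlock Δ c j ∈ U (1 - b) with hS'
    have hcov : S ∪ S' = Finset.univ := by
      ext j
      simp only [Finset.mem_union, Finset.mem_filter, Finset.mem_univ, true_and, iff_true, hS, hS']
      exact Finset.mem_union.mp (hc (hmemC c j))
    by_cases hSe : S.Nonempty
    · by_cases hSe' : S'.Nonempty
      · exfalso
        obtain ⟨j, hj, j', hj', h0⟩ :=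
          exists_pderiv_pderiv_anf_eq_zero_of_union_eq_univ K Δ hSe hSe' hcov
        have hj1 : anfBlock Δ c j ∈ U b := (Finset.mem_filter.mp hj).2
        have hj2 : anfBlock Δ c j' ∈ U (1 - b) := (Finset.mem_filter.mp hj').2
        refine hpair b _ hj1 _ hj2 ?_
        -- same block: `∂∂ ANF_{Δ+1} = A_{sib} · (∂∂ ANF_Δ)^{(c)} = 0`
        have := pderiv_pderiv_anf_succ_same (K := K) Δ c j' j
        rw [this, h0, map_zero, mul_zero]
      · left
        intro x hx
        obtain ⟨j, -, rfl⟩ := Finset.mem_image.mp hx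
        rcases Finset.mem_union.mp (hc (hmemC c j)) with h | h
        · exact h
        · exact absurd ⟨j, Finset.mem_filter.mpr ⟨Finset.mem_univ _, h⟩⟩ hSe'
    · right
      intro x hx
      obtain ⟨j, -, rfl⟩ := Finset.mem_image.mp hx
      rcases Finset.mem_union.mp (hc (hmemC c j)) with h | h
      · exact absurd ⟨j, Finset.mem_filter.mpr ⟨Finset.mem_univ _, h⟩⟩ hSe
      · exact h
  -- (F10) each `U b` is a quarter, paired with the sibling quarter of the same half
  have heq : ∀ c b', C c ⊆ U b' → (U b').card = 4 ^ Δ → U b' = C c := fun c b' h hc =>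
    (Finset.eq_of_subset_of_card_le h (by rw [hc, hCcard])).symm
  have hshape : ∀ b, (U b = C 0 ∧ U (1 - b) = C 1) ∨ (U b = C 1 ∧ U (1 - b) = C 0) ∨
      (U b = C 2 ∧ U (1 - b) = C 3) ∨ (U b = C 3 ∧ U (1 - b) = C 2) := by
    intro b
    rcases hhalf b with ⟨hb, hb'⟩ | ⟨hb, hb'⟩
    · obtain ⟨hcb, hunion⟩ := hfill b lo hlocard hb hb'
      have hcb' : (U (1 - b)).card = 4 ^ Δ :=
        (hfill (1 - b) lo hlocard hb' (by rwa [one_sub_one_sub])).1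
      have h0 : C 0 ⊆ U b ∪ U (1 - b) := hunion ▸ Finset.subset_union_left
      have h1 : C 1 ⊆ U b ∪ U (1 - b) := hunion ▸ Finset.subset_union_right
      rcases hquarter b 0 h0 with h0b | h0b' <;> rcases hquarter b 1 h1 with h1b | h1b'
      · exfalso
        have hsub : lo ⊆ U b := Finset.union_subset h0b h1b
        have := Finset.card_le_card hsub
        omega
      · exact Or.inl ⟨heq 0 b h0b hcb, heq 1 (1 - b) h1b' hcb'⟩
      · exact Or.inr (Or.inl ⟨heq 1 b h1b hcb, heq 0 (1 - b) h0b' hcb'⟩)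
      · exfalso
        have hsub : lo ⊆ U (1 - b) := Finset.union_subset h0b' h1b'
        have := Finset.card_le_card hsub
        omega
    · obtain ⟨hcb, hunion⟩ := hfill b hi hhicard hb hb'
      have hcb' : (U (1 - b)).card = 4 ^ Δ :=
        (hfill (1 - b) hi hhicard hb' (by rwa [one_sub_one_sub])).1
      have h2 : C 2 ⊆ U b ∪ U (1 - b) := hunion ▸ Finset.subset_union_left
      have h3 : C 3 ⊆ U b ∪ U (1 - b) := hunion ▸ Finset.subset_union_right
      rcases hquarter b 2 h2 with h2b | h2b' <;> rcases hquarter b 3 h3 with h3b | h3b'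
      · exfalso
        have hsub : hi ⊆ U b := Finset.union_subset h2b h3b
        have := Finset.card_le_card hsub
        omega
      · exact Or.inr (Or.inr (Or.inl ⟨heq 2 b h2b hcb, heq 3 (1 - b) h3b' hcb'⟩))
      · exact Or.inr (Or.inr (Or.inr ⟨heq 3 b h3b hcb, heq 2 (1 - b) h2b' hcb'⟩))
      · exfalso
        have hsub : hi ⊆ U (1 - b) := Finset.union_subset h2b' h3b'
        have := Finset.card_le_card hsub
        omega
  -- the block map `π`
  have hexists : ∀ b, ∃ c, U b = C c := by
    intro b
    rcases hshape b with h | h | h | h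
    exacts [⟨0, h.1⟩, ⟨1, h.1⟩, ⟨2, h.1⟩, ⟨3, h.1⟩]
  choose π hπ using hexists
  have hCinj : ∀ c c', C c = C c' → c = c' := by
    intro c c' h
    by_contra hne'
    have hd := disjoint_image_anfBlock Δ hne' Finset.univ Finset.univ
    have he : C c' = ∅ := by
      have hd' : Disjoint (C c') (C c') := by
        change Disjoint (C c) (C c') at hd
        rwa [h] at hd
      exact (Finset.disjoint_self_iff_empty _).mp hd'
    have := hCcard c'
    rw [he, Finset.card_empty] at this
    omega
  have hsib : ∀ b, π (1 - b) = 1 - π b := by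
    intro b
    rcases hshape b with h | h | h | h
    · rw [hCinj _ _ ((hπ b).symm.trans h.1), hCinj _ _ ((hπ (1 - b)).symm.trans h.2)]; decide
    · rw [hCinj _ _ ((hπ b).symm.trans h.1), hCinj _ _ ((hπ (1 - b)).symm.trans h.2)]; decide
    · rw [hCinj _ _ ((hπ b).symm.trans h.1), hCinj _ _ ((hπ (1 - b)).symm.trans h.2)]; decide
    · rw [hCinj _ _ ((hπ b).symm.trans h.1), hCinj _ _ ((hπ (1 - b)).symm.trans h.2)]; decide
  have hπinj : Function.Injective π := by
    intro b₁ b₂ h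
    by_contra hb
    have hb2 : b₂ ≠ 1 - b₁ := by
      rintro rfl
      rw [hsib] at h
      exact one_sub_ne (π b₁) h.symm
    have hcov4 : ∀ b₁ b₂ d : Fin 4, b₁ ≠ b₂ → b₂ ≠ 1 - b₁ →
        (d = b₁ ∨ d = 1 - b₁ ∨ d = b₂ ∨ d = 1 - b₂) := by decide
    set c := π b₁ with hc
    have hHcard : (C c ∪ C (1 - c)).card = 2 * 4 ^ Δ := by
      rw [Finset.card_union_of_disjoint (disjoint_image_anfBlock Δ (one_sub_ne c).symm _ _), hCcard,
        hCcard]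
      ring
    refine hnotall _ hHcard fun d => ?_
    rcases hcov4 b₁ b₂ d hb hb2 with rfl | rfl | rfl | rfl
    · rw [hπ, ← hc]; exact Finset.subset_union_left
    · rw [hπ, hsib, ← hc]; exact Finset.subset_union_right
    · rw [hπ, ← h]; exact Finset.subset_union_left
    · rw [hπ, hsib, ← h]; exact Finset.subset_union_right
  exact ⟨Equiv.ofBijective π (Finite.injective_iff_bijective.mp hπinj), hsib, hπ⟩

end Quarters


/-! ### Block matrices of a quarter-block-monomial change of basis -/

section Blocks

variable {K : Type*} [Field K]

/-- **The diagonal blocks are invertible.** If the rows `x^{(b)}` of an invertible `M` are supported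
on the columns `x^{(c)}`, the block `M_b = (M_{x^{(b)}_j, x^{(c)}_{j'}})_{j,j'}` is invertible (its rows
are the independent rows of `M` read on their support).
[cite: MediniShpilka2021, proof of Lemma 5.13 (arXiv p0029:L3-L26); folklore linear algebra] -/
theorem isUnit_det_blockOf_anfBlock (Δ : ℕ) (M : Matrix (Fin (4 ^ (Δ + 1))) (Fin (4 ^ (Δ + 1))) K)
    (hM : IsUnit M.det) (b c : Fin 4)
    (hsupp : ∀ j k, M (anfBlock Δ b j) k ≠ 0 → ∃ j', k = anfBlock Δ c j') :
    IsUnit (Matrix.of fun j j' => M (anfBlock Δ b j) (anfBlock Δ c j')).det := by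
  classical
  set N : Matrix (Fin (4 ^ Δ)) (Fin (4 ^ Δ)) K := Matrix.of fun j j' => M (anfBlock Δ b j) (anfBlock Δ c j')
    with hN
  have hrows : LinearIndependent K (fun i => M i) :=
    Matrix.linearIndependent_rows_iff_isUnit.mpr ((Matrix.isUnit_iff_isUnit_det M).mpr hM)
  have hR : LinearIndependent K (fun j => M (anfBlock Δ b j)) :=
    hrows.comp (anfBlock Δ b) (anfBlock_injective Δ b)
  have hNrows : LinearIndependent K (fun j => N j) := by
    rw [Fintype.linearIndependent_iff]
    intro g hg
    have hfull : ∑ j, g j • M (anfBlock Δ b j) = 0 := by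
      funext k
      rw [Finset.sum_apply, Pi.zero_apply]
      by_cases hk : ∃ j', k = anfBlock Δ c j'
      · obtain ⟨j', rfl⟩ := hk
        have := congr_fun hg j'
        rw [Finset.sum_apply, Pi.zero_apply] at this
        simpa [hN, Pi.smul_apply, Matrix.of_apply] using this
      · exact Finset.sum_eq_zero fun j _ => by
          rw [Pi.smul_apply]
          have : M (anfBlock Δ b j) k = 0 := by
            by_contra hne
            exact hk (hsupp j k hne)
          rw [this, smul_zero]
    exact Fintype.linearIndependent_iff.mp hR g hfull
  exact (Matrix.isUnit_iff_isUnit_det N).mp (Matrix.linearIndependent_rows_iff_isUnit.mp hNrows)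

/-- `affSubst le_rfl M 0` unfolded (no translation part). [cite: MediniShpilka2021, §1.1.6 eq. (2)] -/
private theorem affSubst_le_rfl_zero (N : ℕ) (M : Matrix (Fin N) (Fin N) K) (f : MvPolynomial (Fin N) K) :
    affSubst le_rfl M 0 f = aeval (fun v : Fin N => ∑ w, C (M v w) * X w) f := by
  unfold affSubst
  exact congrArg (fun F : Fin N → MvPolynomial (Fin N) K => aeval F f) (funext fun v => by
    simp only [Fin.castLE_rfl, id_eq, Pi.zero_apply, C_0, add_zero])

/-- **Substitution factorises through the blocks.** If the rows `x^{(b)}` of `M` are supported on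
the columns `x^{(c)}`, then `(p(x^{(b)}))(My) = (p ∘ M_b)(x^{(c)})`.
[cite: MediniShpilka2021, proof of Lemma 5.13 (arXiv p0029:L3-L26)] -/
theorem affSubst_rename_anfBlock (Δ : ℕ) (M : Matrix (Fin (4 ^ (Δ + 1))) (Fin (4 ^ (Δ + 1))) K)
    (b c : Fin 4) (hsupp : ∀ j k, M (anfBlock Δ b j) k ≠ 0 → ∃ j', k = anfBlock Δ c j')
    (p : MvPolynomial (Fin (4 ^ Δ)) K) :
    affSubst le_rfl M 0 (rename (anfBlock Δ b) p) =
      rename (anfBlock Δ c)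
        (affSubst le_rfl (Matrix.of fun j j' => M (anfBlock Δ b j) (anfBlock Δ c j')) 0 p) := by
  classical
  rw [affSubst_le_rfl_zero, affSubst_le_rfl_zero, aeval_rename, ← AlgHom.comp_apply, comp_aeval]
  refine congrArg (fun F : Fin (4 ^ Δ) → MvPolynomial (Fin (4 ^ (Δ + 1))) K => aeval F p)
    (funext fun j => ?_)
  simp only [Function.comp_apply, map_sum, map_mul, rename_C, rename_X, Matrix.of_apply]
  rw [sum_eq_sum_anfBlock Δ]
  rw [Finset.sum_eq_single c]
  · intro b' _ hb'
    refine Finset.sum_eq_zero fun a _ => ?_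
    have : M (anfBlock Δ b j) (anfBlock Δ b' a) = 0 := by
      by_contra hne
      obtain ⟨j', hj'⟩ := hsupp j _ hne
      exact hb' (anfBlock_inj hj').1
    rw [this, C_0, zero_mul]
  · intro h; exact absurd (Finset.mem_univ c) h

end Blocks

/-! ### Support conclusion and the induction step of the structure lemma -/

section Structure

variable {K : Type*} [Field K]

/-- `affSubst` is additive and multiplicative (it is an algebra map). [cite: MediniShpilka2021, §1.1.6 eq. (2)] -/
private theorem affSubst_add_mul (N : ℕ) (M : Matrix (Fin N) (Fin N) K) (f g f' g' : MvPolynomial (Fin N) K) :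
    affSubst le_rfl M 0 (f * g + f' * g') =
      affSubst le_rfl M 0 f * affSubst le_rfl M 0 g + affSubst le_rfl M 0 f' * affSubst le_rfl M 0 g' := by
  unfold affSubst
  rw [map_add, map_mul, map_mul]

/-- **Support conclusion.** If `M` is quarter-block-monomial along a pairing-compatible block
permutation `π` and every diagonal block `M_b` satisfies `mon(ANF_Δ ∘ M_b) ⊆ mon(ANF_Δ)`, then
`mon(ANF_{Δ+1} ∘ M) ⊆ mon(ANF_{Δ+1})`: `ANF_{Δ+1} ∘ M = Q_{0}^{(π0)} Q_{1}^{(π1)} + Q_{2}^{(π2)} Q_{3}^{(π3)}`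
with `{π0, π1}`, `{π2, π3}` sibling quarters, and monomials of products on disjoint blocks are sums of
block monomials. [cite: MediniShpilka2021, proofs of Lemma 5.12 (arXiv p0028:L9-L36) and Lemma 5.13 (p0029:L3-L26)] -/
theorem support_affSubst_anf_succ_subset_of_blocks (Δ : ℕ)
    (M : Matrix (Fin (4 ^ (Δ + 1))) (Fin (4 ^ (Δ + 1))) K) (π : Equiv.Perm (Fin 4))
    (hπ : ∀ b, π (1 - b) = 1 - π b)
    (hsupp : ∀ b j k, M (anfBlock Δ b j) k ≠ 0 → ∃ j', k = anfBlock Δ (π b) j')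
    (hIH : ∀ b, (affSubst le_rfl (Matrix.of fun j j' => M (anfBlock Δ b j) (anfBlock Δ (π b) j')) 0
      (anf K Δ)).support ⊆ (anf K Δ).support) :
    (affSubst le_rfl M 0 (anf K (Δ + 1))).support ⊆ (anf K (Δ + 1)).support := by
  classical
  set Q : Fin 4 → MvPolynomial (Fin (4 ^ Δ)) K := fun b =>
    affSubst le_rfl (Matrix.of fun j j' => M (anfBlock Δ b j) (anfBlock Δ (π b) j')) 0 (anf K Δ) with hQ
  have hfac : ∀ b, affSubst le_rfl M 0 (rename (anfBlock Δ b) (anf K Δ)) = rename (anfBlock Δ (π b)) (Q b) :=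
    fun b => affSubst_rename_anfBlock Δ M b (π b) (hsupp b) (anf K Δ)
  rw [anf_succ, affSubst_add_mul, hfac, hfac, hfac, hfac]
  have h10 : π 1 = 1 - π 0 := by have := hπ 0; rwa [sub_zero] at this
  have h32 : π 3 = 1 - π 2 := by have := hπ 2; rwa [show (1 : Fin 4) - 2 = 3 from by decide] at this
  -- one block product
  have hprod : ∀ b, (rename (anfBlock Δ (π b)) (Q b) * rename (anfBlock Δ (1 - π b)) (Q (1 - b))).support ⊆
      (anf K (Δ + 1)).support := by
    intro b m hm
    have hne : π b ≠ 1 - π b := fun h => (show (1 - π b : Fin 4) ≠ π b by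
      generalize π b = c; revert c; decide) h.symm
    obtain ⟨m₁, hm₁, m₂, hm₂, rfl⟩ := (mem_support_rename_anfBlock_mul_iff Δ hne _ _).mp hm
    rw [support_anf_succ Δ (π b)]
    exact Finset.mem_union_left _
      ((mem_support_rename_anfBlock_mul_iff Δ hne _ _).mpr ⟨m₁, hIH b hm₁, m₂, hIH (1 - b) hm₂, rfl⟩)
  intro m hm
  rcases Finset.mem_union.mp (support_add hm) with h | h
  · rw [h10] at h
    have h' := hprod 0
    rw [sub_zero] at h'
    exact h' h
  · rw [h32] at h
    have h' := hprod 2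
    rw [show (1 : Fin 4) - 2 = 3 from by decide] at h'
    exact h' h

/-- **Induction step of the structure lemma (downstream half).** Let `M ∈ GL_{4^{Δ+1}}(K)` and
`P = ANF_{Δ+1}(My)`. Assume the three consequences of "every second-order Hasse operator killing
`ANF_{Δ+1}` kills `P`" extracted by the block expansion of `Δ²_c(A₀A₁ + A₂A₃)` (seat t18's half):
(AB) no pair `k ∈ U_b`, `l ∈ U_{sib b}` with `∂_k∂_l ANF_{Δ+1} = 0`, where `U_b` is the column support of
the row block `x^{(b)}` of `M`; (H) `Δ²_{c_k ∘ x^{(b)}} ANF_Δ = 0` for every column `c_k` and block `b`;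
(P) `∂_{c_k ∘ x^{(b)}} ∂_{c_l ∘ x^{(b)}} ANF_Δ = 0` for every `+`-pair `(k,l)` and block `b`. Assume the
structure lemma at level `Δ` (induction hypothesis `ih`, the upstairs shape of `hstruct`). Then `mon(P) ⊆ mon(ANF_{Δ+1})`:
by the quarter combinatorics `M` is quarter-block-monomial, its diagonal blocks are invertible and
inherit the hypotheses (read upstairs, in the shape of `hstruct`), and the support conclusion
applies. (Characteristic-free replacement of the `x_i² | x^e` bullet of the printed proof of Lemma 5.13.)
[cite: MediniShpilka2021, Lemma 5.13 and its proof (arXiv p0029:L3-L26); Lemma 5.12 (p0027:L40-p0028:L40)] -/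
theorem support_affSubst_anf_succ_subset (Δ : ℕ)
    (ih : ∀ N : Matrix (Fin (4 ^ Δ)) (Fin (4 ^ Δ)) K, IsUnit N.det →
      (∀ j, hasseD 2 (fun a => N a j) (anf K Δ) = 0) →
      (∀ j j', pderiv j (pderiv j' (anf K Δ)) = 0 →
        (∑ a, ∑ a', C (N a j * N a' j') * pderiv a (pderiv a' (anf K Δ))) = 0) →
      (affSubst le_rfl N 0 (anf K Δ)).support ⊆ (anf K Δ).support)
    (M : Matrix (Fin (4 ^ (Δ + 1))) (Fin (4 ^ (Δ + 1))) K) (hM : IsUnit M.det)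
    (hAB : ∀ (b : Fin 4) (k l : Fin (4 ^ (Δ + 1))), pderiv k (pderiv l (anf K (Δ + 1))) = 0 →
      (∃ j, M (anfBlock Δ b j) k ≠ 0) → (∃ j, M (anfBlock Δ (1 - b) j) l ≠ 0) → False)
    (hH : ∀ (b : Fin 4) (k : Fin (4 ^ (Δ + 1))),
      hasseD 2 (fun a => M (anfBlock Δ b a) k) (anf K Δ) = 0)
    (hP : ∀ (b : Fin 4) (k l : Fin (4 ^ (Δ + 1))), pderiv k (pderiv l (anf K (Δ + 1))) = 0 →
      (∑ a, ∑ a', C (M (anfBlock Δ b a) k * M (anfBlock Δ b a') l) *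
        pderiv a (pderiv a' (anf K Δ))) = 0) :
    (affSubst le_rfl M 0 (anf K (Δ + 1))).support ⊆ (anf K (Δ + 1)).support := by
  classical
  -- column supports of the row blocks
  set U : Fin 4 → Finset (Fin (4 ^ (Δ + 1))) := fun b =>
    Finset.univ.filter fun k => ∃ j, M (anfBlock Δ b j) k ≠ 0 with hU
  have hmemU : ∀ b k, k ∈ U b ↔ ∃ j, M (anfBlock Δ b j) k ≠ 0 := fun b k => by
    simp only [hU, Finset.mem_filter, Finset.mem_univ, true_and]
  have hcard : ∀ b, 4 ^ Δ ≤ (U b).card := by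
    intro b
    have h := card_le_card_of_rows_supportedOn M hM (Finset.univ.image (anfBlock Δ b)) (U b)
      (fun i hi k hk => by
        obtain ⟨j, -, rfl⟩ := Finset.mem_image.mp hi
        by_contra hne
        exact hk ((hmemU b k).mpr ⟨j, hne⟩))
    rwa [card_image_anfBlock] at h
  have hall : 4 ^ (Δ + 1) ≤ (Finset.univ.filter fun k => ∃ b, k ∈ U b).card := by
    have h := card_le_card_of_rows_supportedOn M hM Finset.univ
      (Finset.univ.filter fun k => ∃ b, k ∈ U b) (fun i _ k hk => by
        obtain ⟨b, j, rfl⟩ := exists_eq_anfBlock Δ i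
        by_contra hne
        exact hk (Finset.mem_filter.mpr ⟨Finset.mem_univ _, b, (hmemU b k).mpr ⟨j, hne⟩⟩))
    rwa [Finset.card_univ, Fintype.card_fin] at h
  have hpair : ∀ b, ∀ k ∈ U b, ∀ l ∈ U (1 - b), pderiv k (pderiv l (anf K (Δ + 1))) ≠ 0 :=
    fun b k hk l hl h0 => hAB b k l h0 ((hmemU b k).mp hk) ((hmemU (1 - b) l).mp hl)
  obtain ⟨π, hπ, hUπ⟩ := exists_perm_eq_image_anfBlock Δ U hcard hall hpair
  have hsupp : ∀ b j k, M (anfBlock Δ b j) k ≠ 0 → ∃ j', k = anfBlock Δ (π b) j' := by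
    intro b j k hne
    have hk : k ∈ U b := (hmemU b k).mpr ⟨j, hne⟩
    rw [hUπ b] at hk
    obtain ⟨j', -, hj'⟩ := Finset.mem_image.mp hk
    exact ⟨j', hj'.symm⟩
  -- the diagonal blocks inherit the hypotheses (read upstairs, no chain rule needed)
  have hIH : ∀ b, (affSubst le_rfl (Matrix.of fun j j' => M (anfBlock Δ b j) (anfBlock Δ (π b) j')) 0
      (anf K Δ)).support ⊆ (anf K Δ).support := by
    intro b
    refine ih _ (isUnit_det_blockOf_anfBlock Δ M hM b (π b) (hsupp b)) (fun j' => ?_)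
      (fun j j' h0 => ?_)
    · simp only [Matrix.of_apply]
      exact hH b _
    · have h0' : pderiv (anfBlock Δ (π b) j) (pderiv (anfBlock Δ (π b) j') (anf K (Δ + 1))) = 0 := by
        rw [pderiv_pderiv_anf_succ_same (K := K) Δ (π b) j' j, h0, map_zero, mul_zero]
      simp only [Matrix.of_apply]
      exact hP b _ _ h0'
  exact support_affSubst_anf_succ_subset_of_blocks Δ M π hπ hsupp hIH

/-- **Base of the induction**: `ANF_0 = x`, so `ANF_0 ∘ N = N₀₀ · x` has no new monomial.
[cite: MediniShpilka2021, Def 8 (arXiv p0025:L31)] -/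
theorem support_affSubst_anf_zero_subset (N : Matrix (Fin (4 ^ 0)) (Fin (4 ^ 0)) K) :
    (affSubst le_rfl N 0 (anf K 0)).support ⊆ (anf K 0).support := by
  classical
  have hw : ∀ w : Fin (4 ^ 0), w = ⟨0, by norm_num⟩ := fun w => by
    have h := w.isLt
    simp only [pow_zero] at h
    exact Fin.ext (by simp only; omega)
  have hanf : anf K 0 = X ⟨0, by norm_num⟩ := rfl
  intro m hm
  rw [affSubst_le_rfl_zero, hanf, aeval_X,
    Finset.sum_eq_single (⟨0, by norm_num⟩ : Fin (4 ^ 0)) (fun w _ hw0 => absurd (hw w) hw0)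
      (fun h => absurd (Finset.mem_univ _) h), C_mul_X_eq_monomial] at hm
  rw [hanf, support_X]
  exact support_monomial_subset hm

/-- **The structure lemma from the extraction layer** (packaging by induction on `Δ`). If, at every
level `Δ + 1`, the upstairs hypotheses "`Δ²_{c} ANF_{Δ+1} = 0` along every column `c` of `M` and
`∂_{c}∂_{c'} ANF_{Δ+1} = 0` along the columns of every `+`-pair" yield the three blockwise consequences
(AB), (H), (P), then for every `Δ` and every invertible `N` those hypotheses force
`mon(ANF_Δ ∘ N) ⊆ mon(ANF_Δ)` — the binder `hstruct` of `MS2021_thm_35_of_h512_hstruct`.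

ERRATUM (v2, same seat): as stated this theorem is VACUOUS — its hypothesis `hS3` is required at
EVERY `Δ`, including the step `ANF_0 → ANF_1`, where (AB) fails in general: `ANF_1 = y₀y₁ + y₂y₃` has
non-monomial isometries (e.g. `ℓ₀ = y₀, ℓ₁ = y₁ + t·y₃, ℓ₂ = y₂ − t·y₀, ℓ₃ = y₃`), so no extraction
theorem can supply `hS3 0`. The induction must start at `Δ = 1` with a direct quadratic-form base
case and use the extraction only for `1 ≤ Δ`; this is done in seat t18's
`MS21ANFHasseStructure.lean` (`MS2021.base_one`, `MS2021.support_affSubst_anf_subset_of_cols`, which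
reuses `support_affSubst_anf_zero_subset` and the step machinery of this file's companion) and
packaged as `MS2021.anf_hstruct` (`MS21ANFStructureLemma.lean`), whence `MS2021_thm_35_holds`.
The theorem is kept (true, kernel-checked, referenced by name on the cell's bus) but should not be
cited as the packaging of record.
[cite: MediniShpilka2021, Lemma 5.13 and its proof (arXiv p0029:L3-L26)] -/
theorem support_affSubst_anf_subset_of_extraction
    (hS3 : ∀ (Δ : ℕ) (M : Matrix (Fin (4 ^ (Δ + 1))) (Fin (4 ^ (Δ + 1))) K), IsUnit M.det →
      (∀ k, hasseD 2 (fun a => M a k) (anf K (Δ + 1)) = 0) →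
      (∀ k l, pderiv k (pderiv l (anf K (Δ + 1))) = 0 →
        (∑ a, ∑ a', C (M a k * M a' l) * pderiv a (pderiv a' (anf K (Δ + 1)))) = 0) →
      (∀ (b : Fin 4) (k l : Fin (4 ^ (Δ + 1))), pderiv k (pderiv l (anf K (Δ + 1))) = 0 →
          (∃ j, M (anfBlock Δ b j) k ≠ 0) → (∃ j, M (anfBlock Δ (1 - b) j) l ≠ 0) → False) ∧
        (∀ (b : Fin 4) (k : Fin (4 ^ (Δ + 1))),
          hasseD 2 (fun a => M (anfBlock Δ b a) k) (anf K Δ) = 0) ∧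
        (∀ (b : Fin 4) (k l : Fin (4 ^ (Δ + 1))), pderiv k (pderiv l (anf K (Δ + 1))) = 0 →
          (∑ a, ∑ a', C (M (anfBlock Δ b a) k * M (anfBlock Δ b a') l) *
            pderiv a (pderiv a' (anf K Δ))) = 0))
    (Δ : ℕ) (N : Matrix (Fin (4 ^ Δ)) (Fin (4 ^ Δ)) K) (hN : IsUnit N.det)
    (h2 : ∀ j, hasseD 2 (fun a => N a j) (anf K Δ) = 0)
    (h11 : ∀ j j', pderiv j (pderiv j' (anf K Δ)) = 0 →
      (∑ a, ∑ a', C (N a j * N a' j') * pderiv a (pderiv a' (anf K Δ))) = 0) :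
    (affSubst le_rfl N 0 (anf K Δ)).support ⊆ (anf K Δ).support := by
  induction Δ with
  | zero => exact support_affSubst_anf_zero_subset N
  | succ Δ ih =>
    obtain ⟨hAB, hH, hP⟩ := hS3 Δ N hN h2 h11
    exact support_affSubst_anf_succ_subset Δ (fun N' hN' h2' h11' => ih N' hN' h2' h11') N hN hAB hH hP

end Structure

end MS2021

end Literature.Computability.AlgebraicComplexity

end
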